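import Literature.NumberTheory.Automorphic.CongruenceSubgroupPropertySL2SymbolMulGeneral
import HarnessLib

/-!
# Serre's congruence subgroup property for `SL₂(𝓞_F)` — proofs, XVIII: Liehl's (12)–(14)

Topic `Literature/NumberTheory/Automorphic`; namespace `Literature.NumberTheory.Automorphic.SL2Rel`.
Everything here is PROVED; no definitions.

For the pair `(𝔮, A)`, `A = 𝓞 K`, `K` with a real place and a unit of infinite order, `𝔮 ≠ 0`:
**(12)** `[by over a] = [b over a]` for `(a, b) ∈ W(z²A, yz²A)` (`sym_mul_eq_of_mem_sq`), **(13)**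
`[by over a] = [b over a]` for `(a, b) ∈ W(𝔮, yA)` (`sym_mul_eq`; conjugation by `diag(y, 1)`),
**(14)** `[b over a₁a₂] = [b over a₁][b over a₂]` (`sym_mul_left`).  In the quotient
`G(𝔮, A) ⧸ ncl E(𝔮, A)` equality of classes is membership in `E(𝔮, A)` because `E(𝔮, A)` is normal
((5), `mk_eq_mk_iff`).  MS2 = (7) is the next file.

## References

* [Liehl1981SL2Orders] B. Liehl, J. reine angew. Math. 323 (1981) 153–171, §3 (12)–(14).
-/

open Matrix MatrixGroups NumberField

namespace Literature.NumberTheory.Automorphic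

namespace SL2Rel

section NumberField

variable {K : Type} [Field K] [NumberField K]
variable (hreal : ∃ w : InfinitePlace K, w.IsReal) (hunit : ∃ v : (𝓞 K)ˣ, ∀ n : ℕ, n ≠ 0 → v ^ n ≠ 1)
include hreal hunit

/-- Under (5), `ncl E(𝔮, A) = E(𝔮, A)`: two classes agree iff the quotient lies in `E(𝔮, A)`.
[cite: Liehl1981SL2Orders, §3 (5)] -/
theorem mk_eq_mk_iff {𝔮 : Ideal (𝓞 K)} (h𝔮 : 𝔮 ≠ ⊥) (α β : relG 𝔮 ⊤) :
    (α : SymbGroup 𝔮) = β ↔ ((α : SL(2, 𝓞 K))⁻¹ * β) ∈ relE 𝔮 ⊤ := by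
  haveI := relE_subgroupOf_relG_normal hreal hunit h𝔮 (top_ne_bot : (⊤ : Ideal (𝓞 K)) ≠ ⊥)
  have hncl : Subgroup.normalClosure (relEG 𝔮 : Set (relG 𝔮 ⊤)) = relEG 𝔮 :=
    le_antisymm (Subgroup.normalClosure_le_normal subset_rfl) Subgroup.subset_normalClosure
  rw [QuotientGroup.eq, hncl, Subgroup.mem_subgroupOf]
  rfl

/-- **Liehl (12)** for the pair `(𝔮, A)`: for `0 ≠ z ∈ 𝔮`, `a - 1 ∈ yz⁴A`, `b ∈ z²A`, `(a, b) = 1`: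
`[by over a] = [byz² over a] = [b over a][yz² over a] = [b over a]` by (8), (11), (6).
[cite: Liehl1981SL2Orders, §3 (12)] -/
theorem sym_mul_eq_of_mem_sq {𝔮 : Ideal (𝓞 K)} {z : 𝓞 K} (hz : z ∈ 𝔮) (hz0 : z ≠ 0) (y : 𝓞 K)
    {a b : 𝓞 K} (ha : a - 1 ∈ Ideal.span {y * (z * z * (z * z))}) (hb : b ∈ Ideal.span {z * z})
    (hab : IsCoprime a b) : sym 𝔮 a (b * y) = sym 𝔮 a b := by
  have h𝔮 : 𝔮 ≠ ⊥ := fun h ↦ hz0 (by rw [h] at hz; exact hz)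
  have hzz : z * z ∈ 𝔮 := 𝔮.mul_mem_left _ hz
  have hI𝔮 : Ideal.span {z * z} ≤ 𝔮 := (Ideal.span_singleton_le_iff_mem _).2 hzz
  obtain ⟨s, hs⟩ := Ideal.mem_span_singleton'.1 ha
  have ha𝔮 : a - 1 ∈ 𝔮 := by
    rw [← hs]; exact 𝔮.mul_mem_left _ (𝔮.mul_mem_left _ (𝔮.mul_mem_left _ hzz))
  have hay : IsCoprime a y := ⟨1, -(s * (z * z * (z * z))), by linear_combination -hs⟩
  have hayzz : IsCoprime a (y * (z * z)) := by
    refine hay.mul_right ?_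
    have haz : IsCoprime a z := ⟨1, -(s * y * z * (z * z)), by linear_combination -hs⟩
    exact haz.mul_right haz
  -- (8)
  have ha8 : a - 1 ∈ 𝔮 * Ideal.span {z * z} := by
    rw [← hs, show s * (y * (z * z * (z * z))) = (s * y * (z * z)) * (z * z) by ring]
    exact Ideal.mul_mem_mul (𝔮.mul_mem_left _ hzz) (Ideal.mem_span_singleton_self _)
  have s1 : sym 𝔮 a (z * z * (b * y)) = sym 𝔮 a (b * y) :=
    sym_sq_mul_eq hreal hunit h𝔮 z ha8 (𝔮.mul_mem_right _ (hI𝔮 hb)) (hab.mul_right hay)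
  -- (11)
  have ha4 : a - 1 ∈ Ideal.span {z * z * (z * z)} :=
    Ideal.mem_span_singleton'.2 ⟨s * y, by linear_combination hs⟩
  have s2 := sym_mul_sym hreal hunit hz hz0 ha4 hb
    (Ideal.mem_span_singleton'.2 ⟨y, rfl⟩ : y * (z * z) ∈ Ideal.span {z * z}) hab hayzz
  -- (6): `[yz² over a] = 1`
  have s3 : sym 𝔮 a (y * (z * z)) = 1 :=
    sym_eq_one_of_sub_one_mem_span (𝔮.mul_mem_left _ hzz)
      (Ideal.mem_span_singleton'.2 ⟨s * (z * z), by linear_combination hs⟩)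
  rw [← s1, show z * z * (b * y) = b * (y * (z * z)) by ring, ← s2, s3, mul_one]

omit [NumberField K] hreal hunit in
/-- Conjugation by `diag(y, 1)` maps `E(𝔮, yA)` into `E(𝔮, A)`. [cite: Liehl1981SL2Orders, §3 (13) (proof)] -/
theorem exists_relE_map_eq_diagConj {𝔮 : Ideal (𝓞 K)} {y : 𝓞 K}
    (hy : algebraMap (𝓞 K) K y ≠ 0) {M : SL(2, 𝓞 K)} (hM : M ∈ relE 𝔮 (Ideal.span {y})) :
    ∃ M' ∈ relE 𝔮 ⊤, SpecialLinearGroup.map (algebraMap (𝓞 K) K) M' =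
      diagConj (Units.mk0 _ hy) (SpecialLinearGroup.map (algebraMap (𝓞 K) K) M) := by
  set f := algebraMap (𝓞 K) K with hf
  set r : Kˣ := Units.mk0 _ hy with hr
  refine Subgroup.closure_induction (p := fun M _ ↦ ∃ M' ∈ relE 𝔮 ⊤,
    SpecialLinearGroup.map f M' = diagConj r (SpecialLinearGroup.map f M)) ?_ ?_ ?_ ?_ hM
  · rintro _ (⟨x, hx, rfl⟩ | ⟨c, hc, rfl⟩)
    · refine ⟨e12 (y * x), e12_mem_relE (𝔮.mul_mem_left _ hx), ?_⟩
      rw [map_e12, map_e12, diagConj_e12, hr, Units.val_mk0, map_mul]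
    · rw [SetLike.mem_coe] at hc
      obtain ⟨c', rfl⟩ := Ideal.mem_span_singleton'.1 hc
      refine ⟨e21 c', e21_mem_relE Submodule.mem_top, ?_⟩
      rw [map_e21, map_e21, diagConj_e21, hr, Units.val_inv_eq_inv_val, Units.val_mk0, map_mul]
      congr 1
      field_simp
  · exact ⟨1, one_mem _, by simp⟩
  · rintro M N - - ⟨M', hM', hM'eq⟩ ⟨N', hN', hN'eq⟩
    exact ⟨M' * N', mul_mem hM' hN', by rw [map_mul, hM'eq, hN'eq, map_mul, map_mul]⟩
  · rintro M - ⟨M', hM', hM'eq⟩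
    exact ⟨M'⁻¹, inv_mem hM', by rw [map_inv, hM'eq, map_inv, map_inv]⟩

/-- **Liehl (13)** for the pair `(𝔮, A)`: for `a - 1 ∈ 𝔮y`, `b ∈ 𝔮`, `(a, b) = 1`:
`[by over a] = [b over a]`.  Proof as printed: complete `(a, b)` to `α ∈ G(𝔮, yA)`, write `α = βε`
with `β ∈ G(I', I')`, `I' = yz²A` (`z ∈ 𝔮`), `ε ∈ E(𝔮, yA)`, by (1); for `g = diag(y, 1)`, (12)
gives `gβg⁻¹ ∈ βE(𝔮, A)`, so `α⁻¹gαg⁻¹ ∈ E(𝔮, A)`, and `gαg⁻¹` has first row `(a, by)`.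
[cite: Liehl1981SL2Orders, §3 (13)] -/
theorem sym_mul_eq {𝔮 : Ideal (𝓞 K)} (h𝔮 : 𝔮 ≠ ⊥) (y : 𝓞 K) {a b : 𝓞 K}
    (ha : a - 1 ∈ 𝔮 * Ideal.span {y}) (hb : b ∈ 𝔮) (hab : IsCoprime a b) :
    sym 𝔮 a (b * y) = sym 𝔮 a b := by
  by_cases hy0 : y = 0
  · have ha1 : a = 1 := by
      rw [hy0, Ideal.span_singleton_zero, Ideal.mul_bot, Ideal.mem_bot, sub_eq_zero] at ha
      exact ha
    rw [ha1, hy0, mul_zero, sym_one_zero, sym_one_left hb]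
  set f := algebraMap (𝓞 K) K with hf
  have hinj := map_injective f (IsFractionRing.injective (𝓞 K) K)
  have hy : f y ≠ 0 := fun h ↦ hy0 (IsFractionRing.injective (𝓞 K) K (by rw [h, map_zero]))
  set r : Kˣ := Units.mk0 _ hy with hr
  have ha𝔮 : a - 1 ∈ 𝔮 := Ideal.mul_le_right ha
  obtain ⟨z, hz, hz0⟩ := Submodule.exists_mem_ne_zero_of_ne_bot h𝔮
  have hzz : z * z ∈ 𝔮 := 𝔮.mul_mem_left _ hz
  -- `α ∈ G(𝔮, yA)`, `β = αε ∈ G(I', I')`, `I' = yz²A`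
  obtain ⟨α, hα, h0, h1⟩ := exists_relG_of_row ha hb hab
  set I' : Ideal (𝓞 K) := Ideal.span {y * (z * z)} with hI'
  have hI'0 : I' ≠ ⊥ := by
    rw [hI', Ne, Ideal.span_singleton_eq_bot]; exact mul_ne_zero hy0 (mul_ne_zero hz0 hz0)
  have hI'𝔮 : I' ≤ 𝔮 := (Ideal.span_singleton_le_iff_mem _).2 (𝔮.mul_mem_left _ hzz)
  obtain ⟨ε, hε, hβ⟩ := exists_mul_relE_mem_relG hI'0 hI'𝔮 hα
  -- (12) for `β`: the classes of `β' = gβg⁻¹` and `β` agree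
  set β : SL(2, 𝓞 K) := α * ε with hβdef
  obtain ⟨c₁, hc₁⟩ := Ideal.mem_span_singleton'.1 hβ.2.1
  -- `hc₁ : c₁ * (y * (z * z)) = β 1 0`
  have hβdet : β 0 0 * β 1 1 - y * β 0 1 * (c₁ * (z * z)) = 1 := by
    have := det_two β; rw [← hc₁] at this; linear_combination this
  obtain ⟨β', e00, e01, e10, e11⟩ : ∃ β' : SL(2, 𝓞 K), β' 0 0 = β 0 0 ∧ β' 0 1 = y * β 0 1 ∧
      β' 1 0 = c₁ * (z * z) ∧ β' 1 1 = β 1 1 :=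
    ⟨⟨!![β 0 0, y * β 0 1; c₁ * (z * z), β 1 1], by rw [Matrix.det_fin_two_of]; exact hβdet⟩,
      rfl, rfl, rfl, rfl⟩
  have hβ01 : β 0 1 ∈ 𝔮 := hI'𝔮 hβ.1
  have hβ00 : β 0 0 - 1 ∈ 𝔮 := (Ideal.mul_le_right.trans hI'𝔮) hβ.2.2.1
  have hβG : β ∈ relG 𝔮 ⊤ := relG_mono hI'𝔮 le_top hβ
  have hβ'G : β' ∈ relG 𝔮 ⊤ := by
    refine ⟨?_, Submodule.mem_top, ?_, ?_⟩
    · rw [e01]; exact 𝔮.mul_mem_left _ hβ01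
    · rw [e00, Ideal.mul_top]; exact hβ00
    · rw [e11, Ideal.mul_top]; exact (Ideal.mul_le_right.trans hI'𝔮) hβ.2.2.2
  have h12 : ((⟨β', hβ'G⟩ : relG 𝔮 ⊤) : SymbGroup 𝔮) = (⟨β, hβG⟩ : relG 𝔮 ⊤) := by
    rw [← sym_eq_mk ⟨β', hβ'G⟩ (a := β 0 0) (b := β 0 1 * y) e00 (by rw [e01, mul_comm]),
      ← sym_eq_mk ⟨β, hβG⟩ rfl rfl]
    refine sym_mul_eq_of_mem_sq hreal hunit hz hz0 y ?_ ?_ (isCoprime_row β)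
    · have : I' * I' ≤ Ideal.span {y * (z * z * (z * z))} := by
        rw [hI', Ideal.span_singleton_mul_span_singleton, Ideal.span_singleton_le_span_singleton]
        exact ⟨y, by ring⟩
      exact this hβ.2.2.1
    · exact (Ideal.span_singleton_le_span_singleton.2 ⟨y, by ring⟩ : I' ≤ Ideal.span {z * z}) hβ.1
  rw [mk_eq_mk_iff hreal hunit h𝔮] at h12
  -- `h12 : β'⁻¹ * β ∈ E(𝔮, A)`; and `ι β' = g (ι β) g⁻¹`
  have hgβ : SpecialLinearGroup.map f β' = diagConj r (SpecialLinearGroup.map f β) := by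
    obtain ⟨k00, k01, k10, k11⟩ := diagConj_apply r (SpecialLinearGroup.map f β)
    ext i j
    fin_cases i <;> fin_cases j <;> simp only [Fin.zero_eta, Fin.isValue, Fin.mk_one]
    · rw [k00, map_apply_two, map_apply_two, e00]
    · rw [k01, map_apply_two, map_apply_two, hr, Units.val_mk0, e01, map_mul]
    · rw [k10, map_apply_two, map_apply_two, ← hc₁, e10]
      symm
      rw [Units.inv_mul_eq_iff_eq_mul, hr, Units.val_mk0, ← map_mul]
      congr 1; ring
    · rw [k11, map_apply_two, map_apply_two, e11]
  -- the integral matrix `α'` with `ι α' = g (ι α) g⁻¹`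
  obtain ⟨c₂, hc₂⟩ := Ideal.mem_span_singleton'.1 hα.2.1
  have hαdet : a * α 1 1 - y * b * c₂ = 1 := by
    have := det_two α; rw [h0, h1, ← hc₂] at this; linear_combination this
  obtain ⟨α', a00, a01, a10, a11⟩ : ∃ α' : SL(2, 𝓞 K), α' 0 0 = a ∧ α' 0 1 = y * b ∧
      α' 1 0 = c₂ ∧ α' 1 1 = α 1 1 :=
    ⟨⟨!![a, y * b; c₂, α 1 1], by rw [Matrix.det_fin_two_of]; exact hαdet⟩, rfl, rfl, rfl, rfl⟩
  have hαG : α ∈ relG 𝔮 ⊤ := relG_mono le_rfl le_top hα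
  have hα'G : α' ∈ relG 𝔮 ⊤ := by
    refine ⟨?_, Submodule.mem_top, ?_, ?_⟩
    · rw [a01]; exact 𝔮.mul_mem_left _ hb
    · rw [a00, Ideal.mul_top]; exact ha𝔮
    · rw [a11, Ideal.mul_top]; exact Ideal.mul_le_right hα.2.2.2
  have hgα : SpecialLinearGroup.map f α' = diagConj r (SpecialLinearGroup.map f α) := by
    obtain ⟨k00, k01, k10, k11⟩ := diagConj_apply r (SpecialLinearGroup.map f α)
    ext i j
    fin_cases i <;> fin_cases j <;> simp only [Fin.zero_eta, Fin.isValue, Fin.mk_one]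
    · rw [k00, map_apply_two, map_apply_two, h0, a00]
    · rw [k01, map_apply_two, map_apply_two, h1, hr, Units.val_mk0, a01, map_mul]
    · rw [k10, map_apply_two, map_apply_two, ← hc₂, a10]
      symm
      rw [Units.inv_mul_eq_iff_eq_mul, hr, Units.val_mk0, ← map_mul, mul_comm]
    · rw [k11, map_apply_two, map_apply_two, a11]
  -- `α⁻¹ α' ∈ E(𝔮, A)`
  obtain ⟨M₁, hM₁, hM₁eq⟩ := exists_relE_map_eq_diagConj hy (inv_mem hε)
  change SpecialLinearGroup.map f M₁ = diagConj r (SpecialLinearGroup.map f ε⁻¹) at hM₁eq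
  have key : SpecialLinearGroup.map f (α⁻¹ * α') =
      SpecialLinearGroup.map f (ε * (β'⁻¹ * β)⁻¹ * M₁) := by
    simp only [map_mul, map_inv, hgα, hgβ, hM₁eq, hβdef]
    group
  have hmem : α⁻¹ * α' ∈ relE 𝔮 ⊤ := by
    rw [hinj key]
    exact mul_mem (mul_mem (relE_mono le_rfl le_top hε) (inv_mem h12)) hM₁
  rw [sym_eq_mk ⟨α', hα'G⟩ (a := a) (b := b * y) a00 (by rw [a01, mul_comm]),
    sym_eq_mk ⟨α, hαG⟩ h0 h1]
  exact ((mk_eq_mk_iff hreal hunit h𝔮 ⟨α, hαG⟩ ⟨α', hα'G⟩).2 hmem).symm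

/-- **Liehl (14)** for the pair `(𝔮, A)`: `[b over a₁a₂] = [b over a₁][b over a₂]` for
`(a₁, b), (a₂, b) ∈ W(𝔮, A)`: with `α = (a₂ b; c d)`, `(a₁a₂, b)α⁻¹ = (1 + a₂d(a₁ - 1), a₂b(1 - a₁))`,
and `[a₂b(1 - a₁) over 1 + a₂d(a₁ - 1)] = [b(1 - a₁) over a₁ + bc(a₁ - 1)] = [b over a₁]` by (13), (6).
[cite: Liehl1981SL2Orders, §3 (14)] -/
theorem sym_mul_left {𝔮 : Ideal (𝓞 K)} (h𝔮 : 𝔮 ≠ ⊥) {a₁ a₂ b : 𝓞 K} (ha₁ : a₁ - 1 ∈ 𝔮)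
    (ha₂ : a₂ - 1 ∈ 𝔮) (hb : b ∈ 𝔮) (h₁ : IsCoprime a₁ b) (h₂ : IsCoprime a₂ b) :
    sym 𝔮 (a₁ * a₂) b = sym 𝔮 a₁ b * sym 𝔮 a₂ b := by
  obtain ⟨α, h0, h1, hs₂⟩ := exists_sym_eq_mk ha₂ hb h₂
  have ha₁₂ : a₁ * a₂ - 1 ∈ 𝔮 := by
    rw [show a₁ * a₂ - 1 = (a₁ - 1) * a₂ + (a₂ - 1) by ring]
    exact 𝔮.add_mem (𝔮.mul_mem_right _ ha₁) ha₂
  obtain ⟨γ, k0, k1, hs₁₂⟩ := exists_sym_eq_mk ha₁₂ hb (h₁.mul_left h₂)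
  obtain ⟨α₁, l0, l1, hs₁⟩ := exists_sym_eq_mk ha₁ hb h₁
  rw [hs₁₂, hs₁, hs₂, ← mul_inv_eq_iff_eq_mul, ← QuotientGroup.mk_inv, ← QuotientGroup.mk_mul]
  -- the row of `γ α⁻¹`
  set c := (α : SL(2, 𝓞 K)) 1 0 with hc
  set d := (α : SL(2, 𝓞 K)) 1 1 with hd
  have hdet : a₂ * d - b * c = 1 := by have := det_two (α : SL(2, 𝓞 K)); rwa [h0, h1] at this
  obtain ⟨i00, i01, i10, i11⟩ := inv_apply_two (α : SL(2, 𝓞 K))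
  have r0 : ((γ * α⁻¹ : relG 𝔮 ⊤) : SL(2, 𝓞 K)) 0 0 = 1 + a₂ * d * (a₁ - 1) := by
    rw [Subgroup.coe_mul, Subgroup.coe_inv, mul_apply_two, i00, i10, k0, k1, ← hc, ← hd]
    linear_combination hdet
  have r1 : ((γ * α⁻¹ : relG 𝔮 ⊤) : SL(2, 𝓞 K)) 0 1 = a₂ * b * (1 - a₁) := by
    rw [Subgroup.coe_mul, Subgroup.coe_inv, mul_apply_two, i01, i11, k0, k1, h1, h0]; ring
  rw [← sym_eq_mk (γ * α⁻¹) r0 r1]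
  -- (13) with `y = a₂`
  have hA : 1 + a₂ * d * (a₁ - 1) - 1 ∈ 𝔮 * Ideal.span {a₂} := by
    rw [show 1 + a₂ * d * (a₁ - 1) - 1 = d * (a₁ - 1) * a₂ by ring]
    exact Ideal.mul_mem_mul (𝔮.mul_mem_left _ ha₁) (Ideal.mem_span_singleton_self _)
  have hB : b * (1 - a₁) ∈ 𝔮 := 𝔮.mul_mem_right _ hb
  have hAB : IsCoprime (1 + a₂ * d * (a₁ - 1)) (b * (1 - a₁)) := by
    have := isCoprime_row ((γ * α⁻¹ : relG 𝔮 ⊤) : SL(2, 𝓞 K))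
    rw [r0, r1, show a₂ * b * (1 - a₁) = a₂ * (b * (1 - a₁)) by ring] at this
    exact this.of_mul_right_right
  have s1 := sym_mul_eq hreal hunit h𝔮 a₂ hA hB hAB
  rw [show b * (1 - a₁) * a₂ = a₂ * b * (1 - a₁) by ring] at s1
  rw [s1, show 1 + a₂ * d * (a₁ - 1) = a₁ + (-c) * (b * (1 - a₁)) by linear_combination (a₁ - 1) * hdet]
  -- (6)
  have h₁' : IsCoprime a₁ (b * (1 - a₁)) := h₁.mul_right ⟨1, 1, by ring⟩
  rw [sym_add_mul_left ha₁ hB h₁' (-c), show b * (1 - a₁) = b + (-b) * a₁ by ring,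
    sym_add_mul_right ha₁ hb h₁ (𝔮.neg_mem hb)]
  exact hs₁

end NumberField

end SL2Rel

end Literature.NumberTheory.Automorphic
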